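import Literature.AlgebraicGeometry.Resolution.Henselization
import Literature.AlgebraicGeometry.Resolution.DecompositionFieldApprox
import Literature.AlgebraicGeometry.Resolution.ValuationConjugation
import HarnessLib

/-!
# The henselization is an immediate extension (Kuhlmann 2010, Lemma 2.2) — proof

Sibling PROOFS file of `Henselization.lean` (topic `Literature/AlgebraicGeometry/Resolution`): it
DISCHARGES the named fact `Kuhlmann2010HenselizationImmediate` — F.-V. Kuhlmann, *Elimination of
ramification I*, Trans. AMS 362 (2010) = arXiv:1003.5678, Lemma 2.2: "The henselization `K^h` of
a valued field `(K,v)` … is an immediate separable-algebraic extension" (there quoted from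
general valuation theory, "[En], [R], [W], [Z–S]") — in the ambient rendering of
`Henselization.lean`: for `Ω` algebraically closed with valuation ring `V` and `E ≤ Ω`, the
henselization `E^h = henselization V E` (the decomposition field of `V ∩ E^sep` in the Galois
extension `E^sep | E`) satisfies `IsImmediateOver V E E^h`: every value and every residue of
`E^h` is one of `E`.

## Proof

* `exists_mem_valuation_sub_lt_of_mem_henselization` — **first-order approximation**: for
  `a ∈ E^h`, `a ≠ 0`, there is `b ∈ E` with `|a - b| < |a|`. This is Kuhlmann,
  *Approximation of elements in henselizations*, Manuscripta Math. 136 (2011), Thm. 1.1 (every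
  element of `K^h ∖ K` is weakly distinguished, "in particular, the henselization is an
  immediate extension"). Reduction to the finite level `decompositionField_approx`
  (`DecompositionFieldApprox.lean`): `a` lies in a finite Galois subextension `M | E` of `E^sep`
  (`FiniteGaloisIntermediateField.adjoin`), and is fixed by the decomposition group of `V ∩ M`
  in `Gal(M|E)` — an automorphism `ρ` of `M` stabilising `V ∩ M` lifts to `ρ̃ ∈ Gal(E^sep|E)`,
  the valuation rings `ρ̃(V ∩ E^sep)` and `V ∩ E^sep` agree on `M`, so by the CONJUGATION
  THEOREM over `M` (`exists_smul_eq_of_isGalois`, `ValuationConjugation.lean`) they differ by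
  some `θ ∈ Gal(E^sep|M)`, and `ρ̃⁻¹θ` lies in the decomposition group of `V ∩ E^sep`, fixes `a`,
  whence `ρ a = a`.
* `Kuhlmann2010HenselizationImmediate_holds` — values: `|a| = |b|`; residues: for `a ∈ V`,
  `a - b ∈ 𝔪_V` and `b ∈ V ∩ E`, so `a` and `b` have the same residue.

## Sources

* F.-V. Kuhlmann, *Elimination of ramification I*, Trans. AMS 362 (2010) 5697–5727, Lemma 2.2.
  [Kuhlmann2010]
* F.-V. Kuhlmann, *Approximation of elements in henselizations*, Manuscripta Math. 136 (2011)
  461–474, Thm. 1.1 and §4. [Kuhlmann2011]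

No definition is introduced and no statement of `Henselization.lean` is touched.
-/

noncomputable section

open scoped Pointwise

namespace Literature.AlgebraicGeometry.Resolution

universe u

/-! ### Valuations of a pulled-back valuation ring -/

/-- The valuation of `A.comap f` compares `y, y'` as the valuation of `A` compares `f y, f y'`.
[folklore] -/
theorem comap_valuation_le_iff {F Ω : Type*} [Field F] [Field Ω] (A : ValuationSubring Ω)
    (f : F →+* Ω) (y y' : F) :
    (A.comap f).valuation y ≤ (A.comap f).valuation y' ↔ A.valuation (f y) ≤ A.valuation (f y') := by
  by_cases hy' : y' = 0
  · subst hy'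
    simp only [map_zero, le_zero_iff, map_eq_zero, map_eq_zero_iff f f.injective]
  · have h1 : 0 < (A.comap f).valuation y' := (Valuation.pos_iff _).mpr hy'
    have h2 : 0 < A.valuation (f y') := (Valuation.pos_iff _).mpr ((map_ne_zero f).mpr hy')
    rw [← div_le_one₀ h1, ← map_div₀, ValuationSubring.valuation_le_one_iff, ← div_le_one₀ h2,
      ← map_div₀, ValuationSubring.valuation_le_one_iff, ValuationSubring.mem_comap, map_div₀]

/-- Strict version of `comap_valuation_le_iff`. [folklore] -/
theorem comap_valuation_lt_iff {F Ω : Type*} [Field F] [Field Ω] (A : ValuationSubring Ω)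
    (f : F →+* Ω) (y y' : F) :
    (A.comap f).valuation y < (A.comap f).valuation y' ↔ A.valuation (f y) < A.valuation (f y') := by
  rw [lt_iff_not_ge, lt_iff_not_ge, comap_valuation_le_iff]

/-! ### First-order approximation of the elements of the henselization -/

section Ambient

variable {Ω : Type u} [Field Ω] [IsAlgClosed Ω] (V : ValuationSubring Ω) (E : Subfield Ω)

/-- **Kuhlmann 2011, Thm. 1.1 (first-order form): the elements of the henselization are
approximated to first order from `E`.** For `a ∈ E^h = henselization V E`, `a ≠ 0`, there is
`b ∈ E` with `|a - b|_V < |a|_V`. Reduction of the ambient (infinite Galois) statement to the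
finite level `decompositionField_approx` through a finite Galois subextension `M ∋ a` of
`E^sep | E` and the conjugation theorem over `M` (module docstring).
[cite: Kuhlmann2011, Theorem 1.1] -/
theorem exists_mem_valuation_sub_lt_of_mem_henselization {a : Ω} (ha : a ∈ henselization V E)
    (ha0 : a ≠ 0) : ∃ b ∈ E, V.valuation (a - b) < V.valuation a := by
  classical
  obtain ⟨haS, hfix⟩ := (mem_henselization_iff V E).mp ha
  -- the Galois extension `L = E^sep` of `E`, its valuation ring `VL = V ∩ L`, and `x = a ∈ L`
  set L : IntermediateField E Ω := separableClosure E Ω with hL_def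
  set VL : ValuationSubring L := sepClosureValuationSubring V E with hVL_def
  set x : L := ⟨a, haS⟩ with hx_def
  -- a finite Galois subextension `M ∋ x`
  let M : FiniteGaloisIntermediateField E L := FiniteGaloisIntermediateField.adjoin E {x}
  have hxM : x ∈ M.toIntermediateField := FiniteGaloisIntermediateField.subset_adjoin E {x} rfl
  set xM : M := ⟨x, hxM⟩ with hxM_def
  have hxM0 : xM ≠ 0 := by
    intro h
    apply ha0
    have := congrArg (fun z : M => ((z : L) : Ω)) h
    exact this
  -- the valuation ring `W = V ∩ M` of `M`
  set W : ValuationSubring M := VL.comap (algebraMap M L) with hW_def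
  -- `xM` is fixed by the decomposition group of `W` in `Gal(M|E)`
  have hfixM : ∀ ρ ∈ W.decompositionSubgroup E, ρ • xM = xM := by
    intro ρ hρ
    have hρW : ρ • W = W := MulAction.mem_stabilizer_iff.mp hρ
    -- lift `ρ` to `ρ' ∈ Gal(L|E)`
    set ρ' : L ≃ₐ[E] L := ρ.liftNormal L with hρ'_def
    have hρ'inv : ∀ y : M, ρ'⁻¹ (algebraMap M L y) = algebraMap M L (ρ⁻¹ y) := by
      intro y
      rw [AlgEquiv.aut_inv, AlgEquiv.symm_apply_eq, hρ'_def, AlgEquiv.liftNormal_commutes,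
        AlgEquiv.aut_inv, AlgEquiv.apply_symm_apply]
    -- `ρ' • VL` and `VL` agree on `M`
    have hagree : VL.comap (algebraMap M L) = (ρ' • VL).comap (algebraMap M L) := by
      ext y
      rw [ValuationSubring.mem_comap, ValuationSubring.mem_comap,
        ValuationSubring.mem_pointwise_smul_iff_inv_smul_mem, AlgEquiv.smul_def, hρ'inv]
      change y ∈ W ↔ ρ⁻¹ • y ∈ W
      rw [← ValuationSubring.mem_pointwise_smul_iff_inv_smul_mem (g := ρ), hρW]
    -- conjugation over `M`
    obtain ⟨θ, hθ⟩ := exists_smul_eq_of_isGalois M VL (ρ' • VL) hagree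
    have hθ' : ∀ z : L, (θ.restrictScalars E)⁻¹ • z = θ⁻¹ • z := by
      intro z
      rw [AlgEquiv.smul_def, AlgEquiv.smul_def, AlgEquiv.aut_inv, AlgEquiv.aut_inv,
        AlgEquiv.symm_apply_eq, AlgEquiv.restrictScalars_apply, AlgEquiv.apply_symm_apply]
    have hθE : (θ.restrictScalars E) • VL = θ • VL := by
      ext z
      rw [ValuationSubring.mem_pointwise_smul_iff_inv_smul_mem,
        ValuationSubring.mem_pointwise_smul_iff_inv_smul_mem, hθ']
    -- `σ = ρ'⁻¹ θ` lies in the decomposition group of `VL`, hence fixes `x`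
    set σ : L ≃ₐ[E] L := ρ'⁻¹ * θ.restrictScalars E with hσ_def
    have hσ : σ • VL = VL := by
      rw [hσ_def, mul_smul, hθE, hθ, inv_smul_smul]
    have hσx : σ x = x := hfix σ ((mem_decompositionGroup_iff V E σ).mpr hσ)
    have hθx : θ x = x := θ.commutes xM
    have hρ'x : ρ' x = x := by
      rw [hσ_def, AlgEquiv.mul_apply, AlgEquiv.restrictScalars_apply, hθx, AlgEquiv.aut_inv,
        AlgEquiv.symm_apply_eq] at hσx
      exact hσx.symm
    -- hence `ρ xM = xM`
    rw [AlgEquiv.smul_def]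
    apply (algebraMap M L).injective
    rw [← AlgEquiv.liftNormal_commutes, ← hρ'_def]
    exact hρ'x
  -- the finite-level approximation
  obtain ⟨c, hc⟩ := decompositionField_approx (K := E) W hfixM hxM0
  refine ⟨(c : Ω), c.2, ?_⟩
  have hW' : W = V.comap ((algebraMap L Ω).comp (algebraMap M L)) := by
    rw [hW_def, hVL_def, sepClosureValuationSubring, ValuationSubring.comap_comap]
  rw [hW', comap_valuation_lt_iff, map_sub] at hc
  have e1 : ((algebraMap L Ω).comp (algebraMap M L)) xM = a := rfl
  have e2 : ((algebraMap L Ω).comp (algebraMap M L)) (algebraMap E M c) = (c : Ω) := rfl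
  rw [e1, e2] at hc
  exact hc

/-! ### The discharge -/

/-- **Kuhlmann 2010, Lemma 2.2: the henselization is an immediate extension** — discharge of
the named fact `Kuhlmann2010HenselizationImmediate` of `Henselization.lean`: for `Ω`
algebraically closed with valuation ring `V` and a subfield `E`, every value and every residue
of `E^h = henselization V E` is a value, resp. a residue, of an element of `E`
(`IsImmediateOver V E (henselization V E)`). From the first-order approximation
`exists_mem_valuation_sub_lt_of_mem_henselization`: `|a - b| < |a|` gives `|a| = |b|`, and for
`a ∈ V` also `a ≡ b mod 𝔪_V` with `b ∈ V ∩ E`. [cite: Kuhlmann2010, Lemma 2.2] -/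
theorem Kuhlmann2010HenselizationImmediate_holds : Kuhlmann2010HenselizationImmediate.{u} := by
  intro Ω _ _ V E
  refine ⟨fun a ha ha0 => ?_, fun r hr => ?_⟩
  · obtain ⟨b, hb, hlt⟩ := exists_mem_valuation_sub_lt_of_mem_henselization V E ha ha0
    refine ⟨b, hb, (Valuation.map_eq_of_sub_lt _ ?_).symm⟩
    rwa [Valuation.map_sub_swap]
  · obtain ⟨a, haH, rfl⟩ := (mem_resField_iff V _ r).mp hr
    by_cases ha0 : (a : Ω) = 0
    · have : a = 0 := Subtype.ext ha0
      rw [this, map_zero]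
      exact (resField V E).zero_mem
    · obtain ⟨b, hb, hlt⟩ := exists_mem_valuation_sub_lt_of_mem_henselization V E haH ha0
      have hab : V.valuation ((a : Ω) - b) < 1 :=
        lt_of_lt_of_le hlt ((V.valuation_le_one_iff _).mpr a.2)
      have hbV : b ∈ V := by
        have : b = a - ((a : Ω) - b) := by ring
        rw [this]
        exact sub_mem a.2 ((V.valuation_le_one_iff _).mp hab.le)
      have heq : IsLocalRing.residue V a = IsLocalRing.residue V ⟨b, hbV⟩ := by
        rw [← sub_eq_zero, ← map_sub, IsLocalRing.residue_eq_zero_iff,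
          ValuationSubring.valuation_lt_one_iff]
        exact hab
      rw [heq]
      exact residue_mem_resField V ⟨b, hbV⟩ hb

end Ambient

end Literature.AlgebraicGeometry.Resolution
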